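import Literature.NumberTheory.LFunctions.WeilTwoPrimeOddMarginFBase
import Literature.NumberTheory.LFunctions.WeilTwoPrimeOddMarginFDataP7
import Literature.NumberTheory.LFunctions.WeilTwoPrimeOddMarginFDataDn2
import Literature.NumberTheory.LFunctions.WeilBlockRowsPZ
import HarnessLib

/-!
# Two-prime odd-margin certificate F: dominance of rows 0–4 of `R = S'_odd(κ') − UᵀU` (factored data)

`WeilCert.checkDomRowPZ` with the materialized block `weilCert23FPm`, the factored inverse `weilCert23FDn/weilCert23FLs` and the Bessel block `weilCert23FHp`, by `decide +kernel` row by row; converted to `checkDomRow` by `WeilCert.checkDomRow_of_PZ` in the assembly file. Pure proof file.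
-/

noncomputable section

namespace Literature.NumberTheory.LFunctions

set_option maxHeartbeats 0 in
/-- Kernel check of the dominance of row 0 of `R` (certificate F, factored data). [folklore] -/
theorem checkDomRowPZ1_0_weilCert23F :
    weilCert23FBase.checkDomRowPZ weilCert23FPm weilCert23FDn weilCert23FLs weilCert23FHp weilCert23FKappa' 1 0 = true := by
  decide +kernel

set_option maxHeartbeats 0 in
/-- Kernel check of the dominance of row 1 of `R` (certificate F, factored data). [folklore] -/
theorem checkDomRowPZ1_1_weilCert23F :
    weilCert23FBase.checkDomRowPZ weilCert23FPm weilCert23FDn weilCert23FLs weilCert23FHp weilCert23FKappa' 1 1 = true := by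
  decide +kernel

set_option maxHeartbeats 0 in
/-- Kernel check of the dominance of row 2 of `R` (certificate F, factored data). [folklore] -/
theorem checkDomRowPZ1_2_weilCert23F :
    weilCert23FBase.checkDomRowPZ weilCert23FPm weilCert23FDn weilCert23FLs weilCert23FHp weilCert23FKappa' 1 2 = true := by
  decide +kernel

set_option maxHeartbeats 0 in
/-- Kernel check of the dominance of row 3 of `R` (certificate F, factored data). [folklore] -/
theorem checkDomRowPZ1_3_weilCert23F :
    weilCert23FBase.checkDomRowPZ weilCert23FPm weilCert23FDn weilCert23FLs weilCert23FHp weilCert23FKappa' 1 3 = true := by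
  decide +kernel

set_option maxHeartbeats 0 in
/-- Kernel check of the dominance of row 4 of `R` (certificate F, factored data). [folklore] -/
theorem checkDomRowPZ1_4_weilCert23F :
    weilCert23FBase.checkDomRowPZ weilCert23FPm weilCert23FDn weilCert23FLs weilCert23FHp weilCert23FKappa' 1 4 = true := by
  decide +kernel


end Literature.NumberTheory.LFunctions
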